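import Summits.HodgeConjecture.HodgeConjecture.Theorems.F0P3cStCharTSAdRegularisedDet   -- ★ p851816 (this seat) C7 file 1: the SPLIT case `det_eq_neg_discr_div_det_sq_of_eq_conj_diagonal`
import Literature.LinearAlgebra.Matrix.NonderogatoryCommutantBaseChange            -- ★ `exists_eq_aeval_map_of_commute_of_charpoly_separable`, `minpoly_eq_charpoly_of_charpoly_separable`
import Literature.LinearAlgebra.Matrix.CyclicVectorCompanionMatrix                 -- ★ `exists_conj_eq_of_minpoly_eq_charpoly`
import Mathlib.LinearAlgebra.Matrix.StdBasis
import Mathlib.LinearAlgebra.Determinant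
import Mathlib.FieldTheory.IsAlgClosed.AlgebraicClosure
import HarnessLib

/-!
# F0 · P3c · line LH6 «StCharTS» — ROAD «JAC-ELL» brick C7 (file 2 ∕ 3) «AD-REGULARISED DETERMINANT — DESCENT»: for ANY regular semisimple `t ∈ GL₃(K)` (`χ_t` separable,
# eigenvalues in an extension), every regularised Jacobian operator has `det Φ = −disc(χ_t) ∕ det(t)²` (Harish-Chandra 1970 L. 22's `det((1 − Ad t)|_{𝔤∕𝔱})`)

Cell `pub/hodgecm-mathlib`, crux H413 = `stmt-HodgeConjecture-24833` (lane `--supports … --as helper`), route HCCMUnconditional; seat LH6-p02 (g6), brick C7 «WEIGHT-ID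
elliptic» of LH5-p02 (g6)'s road «JAC-ELL» (memo `F0/P3c/LH5/LH5-p02/g6/ROAD-JAC-ELL.v0.LH5p02g6.md`; dress «A′ + B + C», F0∕P3c 2026-09-02T15:05:53Z).  File 1 ★ p851816
`F0P3cStCharTSAdRegularisedDet` did the SPLIT case `t = g·diag(d)·g⁻¹`; a COMPACT Cartan `T = Z(γ₀) ⊂ U(Φ₃)(L_w)` of type (2) or (3) has eigenvalues OUTSIDE `L_w`, so this file
descends the identity from the algebraic closure.  THEOREMS ONLY; imports ★ file 1 + ★ `NonderogatoryCommutantBaseChange` + ★ `CyclicVectorCompanionMatrix` + Mathlib.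
HONEST LABEL: HC_CM is proved only modulo the 7 printed citations (2 remaining: hLiu418 = `stmt-HodgeConjecture-24832`, h413 = `stmt-HodgeConjecture-24833`) until rung 0 closes;
count-neutral algebra for the ELLIPTIC half of the print residue «WIF» of the (S-𝔇) organ `stub_EllipticPackage` of `Cruxes/H413/Lines/F0_P3c_StCharTSPaydown.lean`; closes no organ.

THE MATHEMATICS.  `Φ : M₃(K) →ₗ[K] M₃(K)` with (h1) `Φ ∘ (Ad_t − 1) = (Ad_{t⁻¹} − 1) ∘ (Ad_t − 1)` and (h2) `Φ Z = Z` for `Zt = tZ`.  TRANSPORT to `K̄ = AlgebraicClosure K` through the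
standard basis (defined over `K`): `Φ' := toLin b' b' ((toMatrix b b Φ).map ι)` satisfies `Φ'(X.map ι) = (Φ X).map ι` (§1) and `det Φ' = ι(det Φ)`; (h1) transports because the
matrix units are defined over `K` (§2 `comp_adSubOne_transport`); (h2) transports because every matrix over `K̄` commuting with `t' = t.map ι` is a `K̄`-POLYNOMIAL in `t'`
(★ `exists_eq_aeval_map_of_commute_of_charpoly_separable` — `t` is nonderogatory) and `Φ'` fixes `t'^m = (t^m).map ι` (§2 `apply_eq_self_transport`).  Over `K̄`, `χ_t` splits with
three distinct non-zero roots `d` (separable; `det t ≠ 0`), `diag(d)` and `t'` are both nonderogatory with the same characteristic polynomial, so `t' = g·diag(d)·g⁻¹`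
(★ `exists_conj_eq_of_minpoly_eq_charpoly`, §3); ★ file 1 gives `det Φ' = −disc(χ_{t'})∕det(t')²`; finally `disc` of a cubic and `det` commute with `ι` (§4) and `ι` is injective.
* §1 `single_map_algebraMap`, **`toLin_map_toMatrix_apply_map`** (`Φ'` extends `Φ`), `det_toLin_map_toMatrix` (`det Φ' = ι (det Φ)`) — any field extension, any `n`;
* §2 `map_conj_sub`, **`comp_adSubOne_transport`** (h1), **`apply_eq_self_transport`** (h2, `n = Fin m`, `χ_t` separable);
* §3 **`exists_eq_conj_diagonal_of_splits`** (`GL₃(E)`, `χ_t` separable and split ⇒ `t = g·diag(d)·g⁻¹`, `d` injective, `dᵢ ∈ Eˣ`);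
* §4 `discr_map_of_degree_eq_three`, **`det_eq_neg_discr_div_det_sq`** — THE K-LEVEL HEAD of C7: `LinearMap.det Φ = −(↑t).charpoly.discr ∕ (↑t).det ^ 2`.
File 3 (`F0P3cStCharTSWeightIdElliptic`): the `F`-form `det_F L̃ = det_K Φ` for C8's `L̃ = (Ad t₀⁻¹ − 1) ∘ pr_𝔪 + pr_𝔱` on `𝔤 = 𝔲(Φ₃)`, and the norm reading `|P|_v = (𝔇.DG (ι t₀))²`.

## References
* [HarishChandra1970] Harish-Chandra, *Harmonic analysis on reductive p-adic groups*, LNM 162 (1970), Lemma 22.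
* [Rogawski1990] J. D. Rogawski, *Automorphic Representations of Unitary Groups in Three Variables*, Ann. of Math. Stud. 123 (1990), §4.9 p. 54 (`D_G`), §12.5 p. 182.
* [HornJohnson2013] R. A. Horn, C. R. Johnson, *Matrix Analysis*, 2nd ed. (2013), Thm 3.2.4.2 (the commutant of a nonderogatory matrix), Thm 3.3.15.
-/

set_option autoImplicit false
-- the mandated namespace has the single-problem summit's repeated segment (`HodgeConjecture.HodgeConjecture`)
set_option linter.dupNamespace false

noncomputable section

open Matrix Polynomial
open scoped MatrixGroups

namespace Summit.HodgeConjecture.HodgeConjecture.Cruxes.H413.F0P3cStCharTSAdRegularisedDescent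

variable {K K' : Type*} [Field K] [Field K'] [Algebra K K'] {n : Type*} [Fintype n] [DecidableEq n]

/-! ## §1 Transport of a `K`-linear operator on `M_n(K)` to `M_n(K')` through the standard basis -/

omit [Fintype n] in
/-- `(E_{kl}(1)).map ι = E_{kl}(1)`. [folklore] -/
theorem single_map_algebraMap (k l : n) :
    (Matrix.single k l (1 : K)).map (algebraMap K K') = Matrix.single k l (1 : K') := by
  ext i j
  simp only [Matrix.map_apply, Matrix.single_apply]
  split_ifs <;> simp

/-- The transported operator `Φ' := toLin b' b' ((toMatrix b b Φ).map ι)` EXTENDS `Φ`: `Φ' (X.map ι) = (Φ X).map ι`. [folklore] -/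
theorem toLin_map_toMatrix_apply_map (Φ : Matrix n n K →ₗ[K] Matrix n n K) (X : Matrix n n K) :
    Matrix.toLin (Matrix.stdBasis K' n n) (Matrix.stdBasis K' n n)
        ((LinearMap.toMatrix (Matrix.stdBasis K n n) (Matrix.stdBasis K n n) Φ).map (algebraMap K K')) (X.map (algebraMap K K')) =
      (Φ X).map (algebraMap K K') := by
  classical
  set b := Matrix.stdBasis K n n with hb
  set b' := Matrix.stdBasis K' n n with hb'
  set M := LinearMap.toMatrix b b Φ with hM
  -- both sides are `K`-linear in `X`; compare them on the basis `b`
  let mapK : Matrix n n K →ₗ[K] Matrix n n K' := (Algebra.linearMap K K').mapMatrix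
  have hmapK : ∀ Y : Matrix n n K, mapK Y = Y.map (algebraMap K K') := fun Y => rfl
  let lhs : Matrix n n K →ₗ[K] Matrix n n K' := ((Matrix.toLin b' b' (M.map (algebraMap K K'))).restrictScalars K) ∘ₗ mapK
  let rhs : Matrix n n K →ₗ[K] Matrix n n K' := mapK ∘ₗ Φ
  suffices h : lhs = rhs by
    have := congrArg (fun f => f X) h
    simpa only [lhs, rhs, LinearMap.coe_comp, Function.comp_apply, LinearMap.coe_restrictScalars, hmapK] using this
  refine b.ext fun q => ?_
  simp only [lhs, rhs, LinearMap.coe_comp, Function.comp_apply, LinearMap.coe_restrictScalars, hmapK]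
  have hbq : (b q).map (algebraMap K K') = b' q := by
    rw [hb, hb', Matrix.stdBasis_eq_single, Matrix.stdBasis_eq_single, single_map_algebraMap]
  rw [hbq, Matrix.toLin_self]
  -- `Φ (b q) = ∑ p, M p q • b p`
  have hΦ : Φ (b q) = ∑ p, M p q • b p := by
    conv_lhs => rw [← b.sum_repr (Φ (b q))]
    simp only [hM, LinearMap.toMatrix_apply]
  rw [hΦ, ← hmapK, map_sum]
  refine Finset.sum_congr rfl fun p _ => ?_
  rw [map_smul, hmapK, Matrix.map_apply, algebraMap_smul, show (b p).map (algebraMap K K') = b' p from by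
    rw [hb, hb', Matrix.stdBasis_eq_single, Matrix.stdBasis_eq_single, single_map_algebraMap]]

/-- `det Φ' = ι (det Φ)`. [folklore] -/
theorem det_toLin_map_toMatrix (Φ : Matrix n n K →ₗ[K] Matrix n n K) :
    LinearMap.det (Matrix.toLin (Matrix.stdBasis K' n n) (Matrix.stdBasis K' n n)
        ((LinearMap.toMatrix (Matrix.stdBasis K n n) (Matrix.stdBasis K n n) Φ).map (algebraMap K K'))) =
      algebraMap K K' (LinearMap.det Φ) := by
  rw [LinearMap.det_toLin, ← LinearMap.det_toMatrix (Matrix.stdBasis K n n), RingHom.map_det, RingHom.mapMatrix_apply]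

/-! ## §2 The two defining relations of a regularised Jacobian operator survive the transport -/

omit [DecidableEq n] in
/-- `Ad` commutes with `map ι`: `(t X t⁻¹ − X).map ι = t' X' t'⁻¹ − X'` for `X' = X.map ι`, `t' = t.map ι`. [folklore] -/
theorem map_conj_sub (t ti X : Matrix n n K) :
    (t * X * ti - X).map (algebraMap K K') = t.map (algebraMap K K') * X.map (algebraMap K K') * ti.map (algebraMap K K') - X.map (algebraMap K K') := by
  rw [Matrix.map_sub _ (map_sub (algebraMap K K')), Matrix.map_mul, Matrix.map_mul]

/-- **`h1` transports**: if `Φ ∘ (Ad_t − 1) = (Ad_{t⁻¹} − 1) ∘ (Ad_t − 1)` over `K`, the transported operator satisfies the same identity over `K'` for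
`t' = t.map ι` (checked on the standard basis, which is defined over `K`). [cite: HarishChandra1970, Lemma 22] -/
theorem comp_adSubOne_transport (t : GL n K) (t' : GL n K') (ht' : (t' : Matrix n n K') = (t : Matrix n n K).map (algebraMap K K'))
    (ht'i : ((t'⁻¹ : GL n K') : Matrix n n K') = ((t⁻¹ : GL n K) : Matrix n n K).map (algebraMap K K'))
    (Φ : Matrix n n K →ₗ[K] Matrix n n K)
    (h1 : Φ ∘ₗ (LinearMap.mulLeftRight K ((t : Matrix n n K), ((t⁻¹ : GL n K) : Matrix n n K)) - LinearMap.id) =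
      (LinearMap.mulLeftRight K (((t⁻¹ : GL n K) : Matrix n n K), (t : Matrix n n K)) - LinearMap.id) ∘ₗ
        (LinearMap.mulLeftRight K ((t : Matrix n n K), ((t⁻¹ : GL n K) : Matrix n n K)) - LinearMap.id)) :
    (Matrix.toLin (Matrix.stdBasis K' n n) (Matrix.stdBasis K' n n)
        ((LinearMap.toMatrix (Matrix.stdBasis K n n) (Matrix.stdBasis K n n) Φ).map (algebraMap K K'))) ∘ₗ
        (LinearMap.mulLeftRight K' ((t' : Matrix n n K'), ((t'⁻¹ : GL n K') : Matrix n n K')) - LinearMap.id) =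
      (LinearMap.mulLeftRight K' (((t'⁻¹ : GL n K') : Matrix n n K'), (t' : Matrix n n K')) - LinearMap.id) ∘ₗ
        (LinearMap.mulLeftRight K' ((t' : Matrix n n K'), ((t'⁻¹ : GL n K') : Matrix n n K')) - LinearMap.id) := by
  classical
  refine (Matrix.stdBasis K' n n).ext fun q => ?_
  have hbq : Matrix.stdBasis K' n n q = (Matrix.stdBasis K n n q).map (algebraMap K K') := by
    rw [Matrix.stdBasis_eq_single, Matrix.stdBasis_eq_single, single_map_algebraMap]
  set X := Matrix.stdBasis K n n q with hX
  have h1X := congrArg (fun f => f X) h1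
  simp only [LinearMap.coe_comp, Function.comp_apply, LinearMap.sub_apply, LinearMap.mulLeftRight_apply, LinearMap.id_apply] at h1X ⊢
  rw [hbq, ht', ht'i, ← map_conj_sub, toLin_map_toMatrix_apply_map, h1X, map_conj_sub, map_conj_sub]

/-- **`h2` transports**: if `Φ` fixes the commutant of `t` (`χ_t` separable), the transported operator fixes the commutant of `t' = t.map ι` — every matrix over
`K'` commuting with `t'` is a `K'`-polynomial in `t'` (★ `exists_eq_aeval_map_of_commute_of_charpoly_separable`), and `Φ'` fixes the powers `t'^m = (t^m).map ι`.
[cite: HornJohnson2013, Thm 3.2.4.2] [cite: HarishChandra1970, Lemma 22] -/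
theorem apply_eq_self_transport {m : ℕ} (t : Matrix (Fin m) (Fin m) K) (hsep : t.charpoly.Separable)
    (Φ : Matrix (Fin m) (Fin m) K →ₗ[K] Matrix (Fin m) (Fin m) K)
    (h2 : ∀ Z : Matrix (Fin m) (Fin m) K, Z * t = t * Z → Φ Z = Z)
    (Z' : Matrix (Fin m) (Fin m) K') (hZ' : Z' * t.map (algebraMap K K') = t.map (algebraMap K K') * Z') :
    Matrix.toLin (Matrix.stdBasis K' (Fin m) (Fin m)) (Matrix.stdBasis K' (Fin m) (Fin m))
        ((LinearMap.toMatrix (Matrix.stdBasis K (Fin m) (Fin m)) (Matrix.stdBasis K (Fin m) (Fin m)) Φ).map (algebraMap K K')) Z' = Z' := by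
  classical
  obtain ⟨p, -, hp⟩ := Literature.LinearAlgebra.Matrix.exists_eq_aeval_map_of_commute_of_charpoly_separable t hsep Z' hZ'.symm
  have hpow : ∀ i : ℕ, Matrix.toLin (Matrix.stdBasis K' (Fin m) (Fin m)) (Matrix.stdBasis K' (Fin m) (Fin m))
      ((LinearMap.toMatrix (Matrix.stdBasis K (Fin m) (Fin m)) (Matrix.stdBasis K (Fin m) (Fin m)) Φ).map (algebraMap K K'))
        ((t.map (algebraMap K K')) ^ i) = (t.map (algebraMap K K')) ^ i := by
    intro i
    have hmap : (t.map (algebraMap K K')) ^ i = (t ^ i).map (algebraMap K K') := by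
      rw [← RingHom.mapMatrix_apply, ← RingHom.mapMatrix_apply, map_pow]
    rw [hmap, toLin_map_toMatrix_apply_map, h2 _ ((Commute.refl t).pow_left i).eq]
  rw [hp, Polynomial.aeval_eq_sum_range, map_sum]
  refine Finset.sum_congr rfl fun i _ => ?_
  rw [map_smul, hpow]

/-! ## §3 Over a field where `χ_t` splits with simple roots, `t` is conjugate to a regular diagonal matrix (`n = 3`) -/

/-- A `3 × 3` invertible matrix over a field `E` whose characteristic polynomial is separable and splits is `g · diag(d) · g⁻¹` with pairwise distinct non-zero `dᵢ`
(the roots; conjugation by ★ `exists_conj_eq_of_minpoly_eq_charpoly`, both sides being nonderogatory). [cite: HornJohnson2013, Thm 3.2.4.2] -/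
theorem exists_eq_conj_diagonal_of_splits {E : Type*} [Field E] (t : GL (Fin 3) E)
    (hsep : (t : Matrix (Fin 3) (Fin 3) E).charpoly.Separable) (hspl : (t : Matrix (Fin 3) (Fin 3) E).charpoly.Splits) :
    ∃ (g : GL (Fin 3) E) (d : Fin 3 → Eˣ), Function.Injective d ∧
      (t : Matrix (Fin 3) (Fin 3) E) = (g : Matrix (Fin 3) (Fin 3) E) * diagonal (fun i => ((d i : Eˣ) : E)) * ((g⁻¹ : GL (Fin 3) E) : Matrix (Fin 3) (Fin 3) E) := by
  classical
  set χ := (t : Matrix (Fin 3) (Fin 3) E).charpoly with hχ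
  have hmon : χ.Monic := Matrix.charpoly_monic _
  have hdeg : χ.natDegree = 3 := by rw [hχ, Matrix.charpoly_natDegree_eq_dim, Fintype.card_fin]
  have hcard : χ.roots.card = 3 := by rw [← hspl.natDegree_eq_card_roots, hdeg]
  obtain ⟨a, b, c, hs⟩ := Multiset.card_eq_three.1 hcard
  have hnd : χ.roots.Nodup := Polynomial.nodup_roots hsep
  rw [hs] at hnd
  have hab : a ≠ b := fun h => (Multiset.nodup_cons.1 hnd).1 (h ▸ Multiset.mem_cons_self _ _)
  have hac : a ≠ c := fun h => (Multiset.nodup_cons.1 hnd).1 (h ▸ Multiset.mem_cons.2 (Or.inr (Multiset.mem_singleton_self _)))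
  have hbc : b ≠ c := fun h => (Multiset.nodup_cons.1 (Multiset.nodup_cons.1 hnd).2).1 (h ▸ Multiset.mem_singleton_self _)
  -- the roots are non-zero (`det t ≠ 0`)
  have hdt : (t : Matrix (Fin 3) (Fin 3) E).det ≠ 0 := ((Matrix.isUnit_iff_isUnit_det _).1 t.isUnit).ne_zero
  have hroot : ∀ r ∈ χ.roots, r ≠ 0 := by
    intro r hr h0
    subst h0
    have h := (Polynomial.mem_roots hmon.ne_zero).1 hr
    rw [Polynomial.IsRoot.def, ← Polynomial.coeff_zero_eq_eval_zero] at h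
    apply hdt
    rw [Matrix.det_eq_sign_charpoly_coeff, ← hχ, h, mul_zero]
  have ha : a ≠ 0 := hroot a (by rw [hs]; exact Multiset.mem_cons_self _ _)
  have hb : b ≠ 0 := hroot b (by rw [hs]; exact Multiset.mem_cons.2 (Or.inr (Multiset.mem_cons_self _ _)))
  have hc : c ≠ 0 := hroot c (by rw [hs]; exact Multiset.mem_cons.2 (Or.inr (Multiset.mem_cons.2 (Or.inr (Multiset.mem_singleton_self _)))))
  -- the diagonal of the roots
  let d : Fin 3 → Eˣ := ![Units.mk0 a ha, Units.mk0 b hb, Units.mk0 c hc]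
  have hd0 : ((d 0 : Eˣ) : E) = a := rfl
  have hd1 : ((d 1 : Eˣ) : E) = b := rfl
  have hd2 : ((d 2 : Eˣ) : E) = c := rfl
  have hdinj : Function.Injective d := by
    intro i j hij
    have hv : ((d i : Eˣ) : E) = ((d j : Eˣ) : E) := by rw [hij]
    fin_cases i <;> fin_cases j <;> first | rfl | (exfalso; first | exact hab hv | exact hac hv | exact hbc hv | exact hab hv.symm | exact hac hv.symm | exact hbc hv.symm)
  set D : Matrix (Fin 3) (Fin 3) E := diagonal (fun i => ((d i : Eˣ) : E)) with hD
  -- `χ_D = χ_t`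
  have hχD : D.charpoly = χ := by
    rw [hD, Matrix.charpoly_diagonal, Fin.prod_univ_three, hd0, hd1, hd2,
      ← Polynomial.prod_multiset_X_sub_C_of_monic_of_roots_card_eq hmon (by rw [hcard, hdeg]), hs]
    simp only [Multiset.insert_eq_cons, Multiset.map_cons, Multiset.map_singleton, Multiset.prod_cons, Multiset.prod_singleton]
    ring
  have hsepD : D.charpoly.Separable := by rw [hχD]; exact hsep
  obtain ⟨S, hS, hSD⟩ := Literature.LinearAlgebra.Matrix.exists_conj_eq_of_minpoly_eq_charpoly (t : Matrix (Fin 3) (Fin 3) E) D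
    (Literature.LinearAlgebra.Matrix.minpoly_eq_charpoly_of_charpoly_separable _ hsep)
    (Literature.LinearAlgebra.Matrix.minpoly_eq_charpoly_of_charpoly_separable _ hsepD) hχD.symm
  -- `t = S · D · S⁻¹`
  refine ⟨Matrix.GeneralLinearGroup.mk'' S hS, d, hdinj, ?_⟩
  have hSv : ((Matrix.GeneralLinearGroup.mk'' S hS : GL (Fin 3) E) : Matrix (Fin 3) (Fin 3) E) = S := rfl
  rw [Matrix.coe_units_inv, hSv, ← hD, hSD]
  symm
  calc S * (S⁻¹ * (t : Matrix (Fin 3) (Fin 3) E) * S) * S⁻¹ = S * (S⁻¹ * ((t : Matrix (Fin 3) (Fin 3) E) * (S * S⁻¹))) := by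
        simp only [Matrix.mul_assoc]
    _ = (t : Matrix (Fin 3) (Fin 3) E) := by
        rw [Matrix.mul_nonsing_inv S hS, Matrix.mul_one, ← Matrix.mul_assoc, Matrix.mul_nonsing_inv S hS, Matrix.one_mul]

/-! ## §4 The discriminant of a cubic commutes with ring maps; the K-level identity -/

/-- `disc(f.map φ) = φ(disc f)` for a cubic over a field (the explicit formula ★ `Polynomial.discr_of_degree_eq_three`). [folklore] -/
theorem discr_map_of_degree_eq_three (f : K[X]) (hf : f.degree = 3) :
    (f.map (algebraMap K K')).discr = algebraMap K K' f.discr := by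
  have hf' : (f.map (algebraMap K K')).degree = 3 := by rw [Polynomial.degree_map]; exact hf
  rw [Polynomial.discr_of_degree_eq_three hf, Polynomial.discr_of_degree_eq_three hf']
  simp only [Polynomial.coeff_map, map_add, map_sub, map_mul, map_pow, map_ofNat]

/-- **C7, K-LEVEL, GENERAL REGULAR SEMISIMPLE `t ∈ GL₃(K)`** (`χ_t` separable; eigenvalues anywhere): every `K`-linear operator `Φ` on `M₃(K)` with
`Φ ∘ (Ad_t − 1) = (Ad_{t⁻¹} − 1) ∘ (Ad_t − 1)` and `Φ = id` on the commutant of `t` has **`det Φ = −disc(χ_t) ∕ det(t)²`** — by transport to `K̄`, where `t` is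
`g·diag(d)·g⁻¹` and the split case applies, and injectivity of `K → K̄`. [cite: HarishChandra1970, Lemma 22] [cite: Rogawski1990, §4.9 p. 54; §12.5 p. 182] -/
theorem det_eq_neg_discr_div_det_sq (t : GL (Fin 3) K) (hsep : (t : Matrix (Fin 3) (Fin 3) K).charpoly.Separable)
    (Φ : Matrix (Fin 3) (Fin 3) K →ₗ[K] Matrix (Fin 3) (Fin 3) K)
    (h1 : Φ ∘ₗ (LinearMap.mulLeftRight K ((t : Matrix (Fin 3) (Fin 3) K), ((t⁻¹ : GL (Fin 3) K) : Matrix (Fin 3) (Fin 3) K)) - LinearMap.id) =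
      (LinearMap.mulLeftRight K (((t⁻¹ : GL (Fin 3) K) : Matrix (Fin 3) (Fin 3) K), (t : Matrix (Fin 3) (Fin 3) K)) - LinearMap.id) ∘ₗ
        (LinearMap.mulLeftRight K ((t : Matrix (Fin 3) (Fin 3) K), ((t⁻¹ : GL (Fin 3) K) : Matrix (Fin 3) (Fin 3) K)) - LinearMap.id))
    (h2 : ∀ Z : Matrix (Fin 3) (Fin 3) K, Z * (t : Matrix (Fin 3) (Fin 3) K) = (t : Matrix (Fin 3) (Fin 3) K) * Z → Φ Z = Z) :
    LinearMap.det Φ = -((t : Matrix (Fin 3) (Fin 3) K).charpoly.discr) / ((t : Matrix (Fin 3) (Fin 3) K).det) ^ 2 := by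
  classical
  -- transport everything to `K̄`
  let K' := AlgebraicClosure K
  let ι : K →+* K' := algebraMap K K'
  have htti : (t : Matrix (Fin 3) (Fin 3) K).map ι * ((t⁻¹ : GL (Fin 3) K) : Matrix (Fin 3) (Fin 3) K).map ι = 1 := by
    rw [← Matrix.map_mul, ← Units.val_mul, mul_inv_cancel, Units.val_one, Matrix.map_one _ (map_zero ι) (map_one ι)]
  have htit : ((t⁻¹ : GL (Fin 3) K) : Matrix (Fin 3) (Fin 3) K).map ι * (t : Matrix (Fin 3) (Fin 3) K).map ι = 1 := by
    rw [← Matrix.map_mul, ← Units.val_mul, inv_mul_cancel, Units.val_one, Matrix.map_one _ (map_zero ι) (map_one ι)]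
  let t' : GL (Fin 3) K' := ⟨(t : Matrix (Fin 3) (Fin 3) K).map ι, ((t⁻¹ : GL (Fin 3) K) : Matrix (Fin 3) (Fin 3) K).map ι, htti, htit⟩
  have ht' : (t' : Matrix (Fin 3) (Fin 3) K') = (t : Matrix (Fin 3) (Fin 3) K).map ι := rfl
  have ht'i : ((t'⁻¹ : GL (Fin 3) K') : Matrix (Fin 3) (Fin 3) K') = ((t⁻¹ : GL (Fin 3) K) : Matrix (Fin 3) (Fin 3) K).map ι := rfl
  set Φ' : Matrix (Fin 3) (Fin 3) K' →ₗ[K'] Matrix (Fin 3) (Fin 3) K' := Matrix.toLin (Matrix.stdBasis K' (Fin 3) (Fin 3)) (Matrix.stdBasis K' (Fin 3) (Fin 3))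
      ((LinearMap.toMatrix (Matrix.stdBasis K (Fin 3) (Fin 3)) (Matrix.stdBasis K (Fin 3) (Fin 3)) Φ).map ι) with hΦ'
  have h1' := comp_adSubOne_transport (K' := K') t t' ht' ht'i Φ h1
  have h2' : ∀ Z' : Matrix (Fin 3) (Fin 3) K', Z' * (t' : Matrix (Fin 3) (Fin 3) K') = (t' : Matrix (Fin 3) (Fin 3) K') * Z' → Φ' Z' = Z' :=
    fun Z' hZ' => apply_eq_self_transport (K' := K') (t : Matrix (Fin 3) (Fin 3) K) hsep Φ h2 Z' hZ'
  -- `χ_{t'} = χ_t.map ι` is separable and splits in `K̄`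
  have hχ' : (t' : Matrix (Fin 3) (Fin 3) K').charpoly = (t : Matrix (Fin 3) (Fin 3) K).charpoly.map ι := by
    rw [ht', Matrix.charpoly_map]
  have hsep' : (t' : Matrix (Fin 3) (Fin 3) K').charpoly.Separable := by rw [hχ']; exact hsep.map
  have hspl' : (t' : Matrix (Fin 3) (Fin 3) K').charpoly.Splits := IsAlgClosed.splits _
  obtain ⟨g, d, hd, htd⟩ := exists_eq_conj_diagonal_of_splits t' hsep' hspl'
  -- the split case over `K̄`
  have hdet' := F0P3cStCharTSAdRegularisedDet.det_eq_neg_discr_div_det_sq_of_eq_conj_diagonal t' g d hd htd Φ' h1' h2'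
  -- read it back in `K`
  have hdeg : (t : Matrix (Fin 3) (Fin 3) K).charpoly.degree = 3 := by
    rw [Polynomial.degree_eq_natDegree (Matrix.charpoly_monic _).ne_zero, Matrix.charpoly_natDegree_eq_dim, Fintype.card_fin]; rfl
  rw [hΦ', det_toLin_map_toMatrix, hχ', discr_map_of_degree_eq_three _ hdeg, ht', ← RingHom.mapMatrix_apply, ← RingHom.map_det,
    ← map_pow, ← map_neg, ← map_div₀] at hdet'
  exact ι.injective hdet'

end Summit.HodgeConjecture.HodgeConjecture.Cruxes.H413.F0P3cStCharTSAdRegularisedDescent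

end
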